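import Summits.BirchSwinnertonDyer.Rank1Residual.Supersingular.KobayashiSqueezeReal
import Summits.BirchSwinnertonDyer.BirchSwinnertonDyer.Theorems.SignedLowerHalvesKobayashiLowerHalfLargeImageTwistToLocus
import HarnessLib

/-!
# Route `SignedLowerHalves`, crux `KobayashiLowerHalfLargeImage` (item stmt-BirchSwinnertonDyer-19001):
# PAIRED DESCENT — the twist-descent step as a KERNEL DOOR in `ℚ`-vocabulary
# (cell `bsd-ssimc`, seat `bsd-ssimc-k3-c3` gen 11; a `--supports … --as helper` file; ONE predicate
# `def` + theorems; closes nothing). Companions: `…LargeImageTwistToLocus.lean` (gen 3),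
# `…LargeImageReduction.lean` (gen 3), `…LargeImageOffLocusBSTWTwist.lean` (gen 2).

PARTITION (cell bsd-ssimc): X7 (A7) × item 3 OFF the Fouquet–Wan locus, twist-reachable pieces B ∪ C
∪ PM (237 + 13 window pairs, MEMO-3 §T / MEMO-5) and road B1 reversed × odd good supersingular `p` —
types-the-object-of (the twist-descent step); closes NONE. THEOREMS + ONE PREDICATE; no named fact, no
OPEN binder; nothing about any curve is asserted; BSD is not proved by any of this.

## What this file records (namespace `Summit.BirchSwinnertonDyer.BirchSwinnertonDyer.Theorems`)

Gen 3's twist-to-locus theorems (`exists_twist_on_fwLocus_of_split_ram[']`) put a quadratic twist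
`W' ~ W^{(q)}` of every piece-B/C curve ON the Fouquet–Wan locus, so MODULO the FW binder Kobayashi's
main conjecture holds for `W'` — not for `W`: "twist descent of the LOWER half is EQUIVALENT to the ±
main conjecture for `E` over the cyclotomic line of `K = ℚ(√q*)` … not in print at non-ordinary `p`"
(MEMO-4 §F.4 / R22, prose). This file makes that sentence a KERNEL statement in `ℚ`-vocabulary:
* `PairedKobayashiLowerDivisibility W W' p ε` (predicate with parameters; NOT a fact, NOT an OPEN
  binder): for all data of the quantifier of `KobayashiLowerDivisibility` for `W` AND for `W'` over the
  SAME `(κ, γ)`: `char X^ε(W) = (g)`, `char X^ε(W') = (g')`, `ι(g·g') = ϖϖ'·ι(L^ε·L'^ε·h)`, `h ∈ Λ`.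
  For `W'` a minimal model of `W^{(d)}`, `p ∤ 2d`, this is the PRODUCT FORM of the Eisenstein half of
  the signed main conjecture for `E` over the cyclotomic `ℤ_p`-extension of `K = ℚ(√d)`
  (`X^ε(E/K^cyc_∞) ≅ X^ε(E/ℚ_∞) ⊕ X^ε(E^{(d)}/ℚ_∞)`: restriction/Shapiro for odd `p`, Skinner–Urban
  2014 Lemma 3.1.5 + 3.2.5 for the ordinary condition, BSTW Part II Lemma 1.17 (ii) for the signed one
  (PRE); `L_p^ε(E/K) = L_p^ε(E)·L_p^ε(E^{(d)})` up to the period unit) — the NATIVE output of every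
  U(3,1) Eisenstein-congruence engine (Wan; BSTW 9.24 + §10; Fouquet–Wan 7.32) BEFORE the Kato
  separation. The kernel never uses this reading.
* `pairedKobayashiLowerDivisibility_of_kobayashiLowerDivisibility` (`KLD W ∧ KLD W' ⇒ Paired`: never
  stronger than the two conjectures); `PairedKobayashiLowerDivisibility.symm`.
* THE DOOR `kobayashiLowerDivisibility_of_paired`: `Paired W W' p ε` + PUBLISHED inputs BY NAME at `W'`
  ONLY (Kobayashi 2003 Thm 1.2 `h12`, Thm 4.1/1.3 `h41` — integral under `p`-adic surjectivity: Serre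
  `p ≥ 5`, Wuthrich Lemma 20 at `p = 3` `hL20` —, Pollack `hPollack`, modularity `hmod`, period unit
  `h5`/`h3`) + (`p` odd good for `W'`, `a_p(W') = 0`, `ρ̄_{W',p}` onto) ⇒ `KobayashiLowerDivisibility
  W p ε` (Kato: `L'^ε = g'k`; `g' ≠ 0` cancels in the domain `ℚ_p⟦T⟧`; `ϖ' ∈ ℤ_p^×` moves into `h`);
  the symmetric door `…_of_paired'`; `pairedKobayashiLowerDivisibility_iff` (⟺ both lower halves).
* X7: `X7.kobayashiLowerDivisibility_of_paired_twist` — `(W, p)` X7, `a_p = 0`, `ρ̄` onto, `W'` ANY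
  globally minimal model of `W^{(d)}` (`d` square-free, `p ∤ 2d`): `KLD W p ε ⟸ Paired W W' p ε` +
  PUB (side conditions on `W'` by the tree's twist lemmas); `X7.exists_…` (item 3's conclusion AT THE
  PAIR); `X7.exists_fwLocus_twist_pairedDoor_of_split_ram` — for a piece-B/C curve the gen-3 partner
  `W'` ON the FW locus comes WITH the door, so the honest missing input at such a pair is ONE K-level
  statement for `(E, ℚ(√q*))`, while `W'` itself has the main conjecture modulo the FW binder.
WHAT THIS IS NOT: not an engine; no binder typed (r3: no K-level claim in print at non-ordinary `p` /
non-square-free `N` — BCS IMRN 2025 ordinary; BSTW 9.24 square-free; FW's auxiliary field RAMIFIES `ℓ₀`,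
so FW's proof does not supply `Paired W W^{(q*)}`); no instance certified for any class (a typed DOOR,
the ± twin of lev's (A3) `X7.ToricPeriodUnitDeepAt`); closes nothing; 0 census moves.

References: [Kobayashi2003] Conjecture (p. 2), Thm 1.2, 1.3/4.1 (p. 8), (3.4)–(3.6); [SkinnerUrban2014]
Lemmas 3.1.5, 3.2.5; [BurungaleSkinnerTianWan2024] II Lemma 1.17 (ii), Thm 9.24 (PRE); [FouquetWan2021]
Thm 4.51, 7.32 (PRE); [Pollack2003] Cor. 5.11, Prop. 6.18; [GreenbergVatsal2000] §3 Rem. 3.4;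
[Wuthrich2014] Lemma 20; cell memos k3-c3 MEMO-3 §T, MEMO-4 §F.4 / R22, MEMO-12 (this gen).
-/

set_option autoImplicit false
set_option linter.dupNamespace false

noncomputable section

open scoped Classical MatrixGroups ModularForm

open CongruenceSubgroup WeierstrassCurve Literature.NumberTheory.EllipticCurves
  Literature.NumberTheory.EllipticCurves.ModularForms
  Literature.NumberTheory.EllipticCurves.Rank1Residual
  Literature.NumberTheory.EllipticCurves.Rank1Residual.Typed
  Literature.NumberTheory.EllipticCurves.Kobayashi2003 ZpExtension
  Summit.BirchSwinnertonDyer.Rank1Residual.Supersingular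

namespace Summit.BirchSwinnertonDyer.BirchSwinnertonDyer.Theorems

/-! ### §1 The predicate -/
section Predicate

/-- **PAIRED signed lower divisibility for `(W, W')` at `(p, ε)`** — the product form. For every
datum of the quantifier of `KobayashiLowerDivisibility W p ε` (`κ` cyclotomic with generator `γ`
matching Pollack's variable, the newform `f` of `W` at level `N_W`, the period ratio `ϖ·Ω_W = Ω⁺_f`, a
Pollack pair `(L⁺, L⁻)`, a Pontryagin-dual datum `D` of `Sel^ε(W/ℚ_∞)`) and every such datum of
`W'` over the SAME `(κ, γ)`: `char X^ε(W) = (g)`, `char X^ε(W') = (g')` and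
`ι(g·g') = ϖϖ' · ι(L^ε · L'^ε · h)` in `ℚ_p⟦T⟧` for some `h ∈ Λ` (`L^ε = kobayashiL ε L⁺ L⁻`,
Kobayashi's labelling). For `W'` a minimal model of `W^{(d)}`, `p ∤ 2d`, this is the Eisenstein half
of the signed main conjecture for `W` over the cyclotomic `ℤ_p`-extension of `ℚ(√d)` in product form
(`X^ε(E/K^cyc_∞) ≅ X^ε(E/ℚ_∞) ⊕ X^ε(E^{(d)}/ℚ_∞)`, Skinner–Urban Lemma 3.1.5 / 3.2.5 pattern). A
predicate with parameters; nothing asserted; implied by `KobayashiLowerDivisibility` for `W` and `W'`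
(`pairedKobayashiLowerDivisibility_of_kobayashiLowerDivisibility`). CONTENT: it is NOT implied by
`KobayashiLowerDivisibility W' p ε` alone, nor by the Kato-side inclusions (`char ∣ L`) at BOTH curves —
those leave the `W`-side generator `g` unbounded from below; under Kato at both curves it is EQUIVALENT
to the two lower halves (`pairedKobayashiLowerDivisibility_iff`). Not asserted in print by anyone at a
non-ordinary `p` for non-square-free `N` (a DOOR, not a binder).
[cite: Kobayashi2003, Conjecture (Main Conjecture) (p. 2) and Thm. 4.1 (p. 8) (shape only; nothing asserted)]
[cite: SkinnerUrban2014, Lemma 3.1.5 (p. 19) and Lemma 3.2.5 (p. 22) (shape only; nothing asserted)] -/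
def PairedKobayashiLowerDivisibility (W W' : WeierstrassCurve ℚ) [W.IsElliptic]
    [W.IsGloballyMinimal] [W'.IsElliptic] [W'.IsGloballyMinimal] (p : ℕ) [Fact p.Prime]
    (ε : ℤˣ) : Prop :=
  ∀ (κ : ZpExtension ℚ p) (γ : Field.absoluteGaloisGroup ℚ),
      κ.IsCyclotomic → κ.IsTopGenerator γ → IsCyclotomicVariable p γ →
    ∀ [NeZero (W.conductorNorm ℤ)] (f : CuspForm (Gamma0 (W.conductorNorm ℤ)) 2),
      IsNewformOf W f → ∀ (ϖ : ℚ), (ϖ : ℝ) * W.realPeriodRat = plusPeriod f →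
    ∀ (Lplus Lminus : IwasawaAlgebra p), IsPollackPair f p Lplus Lminus →
    ∀ (D : SignedSelmerDualData W κ γ ε),
    ∀ [NeZero (W'.conductorNorm ℤ)] (f' : CuspForm (Gamma0 (W'.conductorNorm ℤ)) 2),
      IsNewformOf W' f' → ∀ (ϖ' : ℚ), (ϖ' : ℝ) * W'.realPeriodRat = plusPeriod f' →
    ∀ (Lplus' Lminus' : IwasawaAlgebra p), IsPollackPair f' p Lplus' Lminus' →
    ∀ (D' : SignedSelmerDualData W' κ γ ε),
      ∃ g g' h : IwasawaAlgebra p, D.charIdeal = Ideal.span {g} ∧ D'.charIdeal = Ideal.span {g'} ∧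
        iwasawaToPowerSeries p (g * g') =
          PowerSeries.C ((ϖ * ϖ' : ℚ) : ℚ_[p]) *
            iwasawaToPowerSeries p (kobayashiL ε Lplus Lminus * kobayashiL ε Lplus' Lminus' * h)

variable {W W' : WeierstrassCurve ℚ} [W.IsElliptic] [W.IsGloballyMinimal] [W'.IsElliptic]
  [W'.IsGloballyMinimal] {p : ℕ} [Fact p.Prime] {ε : ℤˣ}

/-- **Kobayashi's lower half for BOTH curves implies the paired lower half** (multiply the two
relations: `h := h_W · h_{W'}`). So `PairedKobayashiLowerDivisibility` is never stronger than the two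
conjectures. [cite: Kobayashi2003, Conjecture (Main Conjecture) (p. 2)] -/
theorem pairedKobayashiLowerDivisibility_of_kobayashiLowerDivisibility
    (h : KobayashiLowerDivisibility W p ε) (h' : KobayashiLowerDivisibility W' p ε) :
    PairedKobayashiLowerDivisibility W W' p ε := by
  intro κ γ hκ hγ hγ' _ f hf ϖ hϖ Lplus Lminus hL D _ f' hf' ϖ' hϖ' Lplus' Lminus' hL' D'
  obtain ⟨g, k, hg, hιg⟩ := h κ γ hκ hγ hγ' f hf ϖ hϖ Lplus Lminus hL D
  obtain ⟨g', k', hg', hιg'⟩ := h' κ γ hκ hγ hγ' f' hf' ϖ' hϖ' Lplus' Lminus' hL' D'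
  refine ⟨g, g', k * k', hg, hg', ?_⟩
  rw [map_mul, hιg, hιg', Rat.cast_mul, map_mul]
  simp only [map_mul]
  ring

/-- **The paired lower half is symmetric in `W ↔ W'`.** [cite: Kobayashi2003, Conjecture (Main Conjecture) (p. 2)] -/
theorem PairedKobayashiLowerDivisibility.symm (h : PairedKobayashiLowerDivisibility W W' p ε) :
    PairedKobayashiLowerDivisibility W' W p ε := by
  intro κ γ hκ hγ hγ' _ f' hf' ϖ' hϖ' Lplus' Lminus' hL' D' _ f hf ϖ hϖ Lplus Lminus hL D
  obtain ⟨g, g', k, hg, hg', hι⟩ :=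
    h κ γ hκ hγ hγ' f hf ϖ hϖ Lplus Lminus hL D f' hf' ϖ' hϖ' Lplus' Lminus' hL' D'
  refine ⟨g', g, k, hg', hg, ?_⟩
  rw [mul_comm g' g, hι, mul_comm ϖ' ϖ, mul_comm (kobayashiL ε Lplus' Lminus')]

end Predicate

/-! ### §2 The door: paired lower half + Kato–Kobayashi at the partner ⇒ Kobayashi's lower half -/
section Door

variable (W W' : WeierstrassCurve ℚ) [W.IsElliptic] [W.IsGloballyMinimal] [W'.IsElliptic]
  [W'.IsGloballyMinimal] (p : ℕ) [Fact p.Prime]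

/-- Kobayashi's `L^ε` picked out of a Pollack pair is non-zero (Pollack's Cor. 5.11, carried by
`IsPollackPair`). [cite: Pollack2003, Cor. 5.11] -/
theorem IsPollackPair.kobayashiL_ne_zero {N : ℕ} [NeZero N] {f : CuspForm (Gamma0 N) 2}
    {Lplus Lminus : IwasawaAlgebra p} (hL : IsPollackPair f p Lplus Lminus) (ε : ℤˣ) :
    kobayashiL ε Lplus Lminus ≠ 0 := by
  unfold kobayashiL
  split_ifs
  · exact hL.2.1
  · exact hL.1

/-- **THE DOOR (twist / partner descent of the Eisenstein half).** Let `p` be odd, `W'` with good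
reduction at `p`, `a_p(W') = 0` and `ρ̄_{W',p}` onto. Granted the PUBLISHED inputs BY NAME, at `W'`
only — Kobayashi 2003 Thm 1.2 (`h12`: `X^ε(W')` f.g. torsion) and Thm 4.1 / 1.3 (`h41`: the Kato-side
inclusion `L'^ε ∈ char X^ε(W')`, integral under `p`-adic surjectivity, which follows from mod-`p`
surjectivity at a good odd `p`: Serre for `p ≥ 5`, Wuthrich 2014 Lemma 20 at `p = 3`, `hL20`), Pollack
(`hPollack`: a Pollack pair for the newform of `W'` exists, `L'^ε ≠ 0`), modularity (`hmod`), and the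
period unit `ϖ' = Ω⁺_{f'}/Ω_{W'} ∈ ℤ_p^×` (`h5`, `h3`; `W'[p]` is irreducible since `a_p(W') = 0`) —
the PAIRED lower half `PairedKobayashiLowerDivisibility W W' p ε` implies Kobayashi's lower half
`KobayashiLowerDivisibility W p ε` for `W` itself. Proof: for a datum of `W`, instantiate a datum of
`W'` over the same `(κ, γ)`; the pairing gives `ι(g g') = ϖϖ'·ι(L^ε L'^ε h)`; Kato gives
`L'^ε = g' k`; `g' ≠ 0` cancels in the domain `ℚ_p⟦T⟧`, leaving `ι g = ϖ·ι(L^ε · (u k h))` with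
`u ∈ ℤ_p^×` the image of `ϖ'`. CONDITIONAL on the predicate (no instance is certified); closes nothing.
[cite: Kobayashi2003, Thm. 1.2 (p. 2), Thm. 4.1 (p. 8) and Conjecture (p. 2)] [cite: Pollack2003, Cor. 5.11 and Prop. 6.18]
[cite: GreenbergVatsal2000, §3, Remark 3.4] [cite: Wuthrich2014, Lemma 20 (p. 399)] -/
theorem kobayashiLowerDivisibility_of_paired
    (h12 : Kobayashi2003.thm12_signedSelmerDual_finite_torsion)
    (h41 : Kobayashi2003.thm41_signedCharIdeal_divisibility)
    (hPollack : ∀ {N : ℕ} [NeZero N] {f : CuspForm (Gamma0 N) 2},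
      pollack_exists_plusMinusPAdicLFunction (W := W') (f := f) (p := p))
    (hmod : nonempty_modularParametrizationData)
    (h5 : realPeriodRat_eq_unit_mul_plusPeriod) (h3 : realPeriodRat_eq_unit_mul_plusPeriod_three)
    (hL20 : Wuthrich2014.lemma20_surjective_threeAdic_of_semistable)
    (hp : p ≠ 2) (hgood' : W'.HasGoodReductionAtPrime p) (hap' : W'.frobeniusTrace p = 0)
    (hs' : Surj W' p) {ε : ℤˣ} (hpair : PairedKobayashiLowerDivisibility W W' p ε) :
    KobayashiLowerDivisibility W p ε := by
  intro κ γ hκ hγ hγ' _ f hf ϖ hϖ Lplus Lminus hPP D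
  -- a datum of `W'` over the same `(κ, γ)`: newform, period ratio, Pollack pair, dual datum
  haveI : NeZero (W'.conductorNorm ℤ) := ⟨(W'.conductorNorm_pos_holds).ne'⟩
  obtain ⟨Dm⟩ := hmod W'
  have hf' : IsNewformOf W' Dm.f := Dm.isNewformOf
  obtain ⟨ϖ', hϖ'pos, hϖ'eq, -⟩ := Dm.exists_rat_mul_realPeriodRat_eq_plusPeriod
  obtain ⟨Lplus', Lminus', hPP'⟩ := exists_isPollackPair hPollack hp hf' hgood' hap'
  obtain ⟨D'⟩ := nonempty_signedSelmerDualData W' κ ε hγ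
  -- the pairing
  obtain ⟨g, g', h, hg, hg', hι⟩ :=
    hpair κ γ hκ hγ hγ' f hf ϖ hϖ Lplus Lminus hPP D Dm.f hf' ϖ' hϖ'eq Lplus' Lminus' hPP' D'
  -- Kato–Kobayashi at `W'`: `g' ∣ L'^ε`
  haveI : Module.Finite (IwasawaAlgebra p) D'.X := h12.moduleFinite hp hgood' hap' hκ hγ D'
  have hX' : Module.IsTorsion (IwasawaAlgebra p) D'.X := h12.isTorsion hp hgood' hap' hκ hγ D'
  set L' := kobayashiL ε Lplus' Lminus' with hL'_def
  have hL' : IsSignedPAdicLFunction Dm.f p ε L' := hPP'.isSignedPAdicLFunction_kobayashiL ε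
  have hsurj' : ∀ m : ℕ, W'.HasSurjectiveModNGaloisRep (p ^ m : ℕ) :=
    surjective_pow_of_surj_of_good W' p hL20 hp hgood' hs'
  obtain ⟨k, hk⟩ : g' ∣ L' :=
    h41.dvd_of_charIdeal_eq_span hp hgood' hap' hf' hκ hγ hγ' hL' D' hX' hsurj' hg'
  -- `g' ≠ 0` (Pollack: `L'^ε ≠ 0`)
  have hL'0 : L' ≠ 0 := IsPollackPair.kobayashiL_ne_zero p hPP' ε
  have hg'0 : g' ≠ 0 := fun h0 ↦ hL'0 (by rw [hk, h0, zero_mul])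
  have hιg'0 : iwasawaToPowerSeries p g' ≠ 0 := fun h0 ↦
    hg'0 (iwasawaToPowerSeries_injective p (by rw [h0, map_zero]))
  -- the period ratio `ϖ'` of `W'` is a `p`-adic unit
  have hirr' : W'.HasIrreducibleModPGaloisRep p :=
    hasIrreducibleModPGaloisRep_of_dvd_frobeniusTrace W' p hp
      (W'.not_dvd_minimalDiscriminantInt_of_hasGoodReductionAtPrime' p hgood')
      (by rw [hap']; exact dvd_zero _)
  have hvϖ' : padicValRat p ϖ' = 0 :=
    padicValRat_periodRatio_eq_zero h5 h3 W' p hp hgood' hirr' Dm.f hf' ϖ' hϖ'eq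
  obtain ⟨u, hu⟩ := exists_units_coe_eq_ratCast hϖ'pos.ne' hvϖ'
  obtain ⟨-, hιu⟩ := span_C_units_mul_eq u (k * h)
  -- cancel `ι g'`
  refine ⟨g, PowerSeries.C (u : ℤ_[p]) * (k * h), hg, mul_right_cancel₀ hιg'0 ?_⟩
  have key : iwasawaToPowerSeries p g * iwasawaToPowerSeries p g' =
      PowerSeries.C (ϖ : ℚ_[p]) * PowerSeries.C (ϖ' : ℚ_[p]) *
        (iwasawaToPowerSeries p (kobayashiL ε Lplus Lminus) *
          (iwasawaToPowerSeries p g' * iwasawaToPowerSeries p k) * iwasawaToPowerSeries p h) := by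
    rw [← map_mul, hι, hk, Rat.cast_mul, map_mul]
    simp only [map_mul]
  rw [key, map_mul, hιu, hu, map_mul]
  ring

/-- **The symmetric door**: published inputs at `W`, conclusion for the partner `W'`.
[cite: Kobayashi2003, Thm. 1.2 (p. 2), Thm. 4.1 (p. 8) and Conjecture (p. 2)] -/
theorem kobayashiLowerDivisibility_of_paired'
    (h12 : Kobayashi2003.thm12_signedSelmerDual_finite_torsion)
    (h41 : Kobayashi2003.thm41_signedCharIdeal_divisibility)
    (hPollack : ∀ {N : ℕ} [NeZero N] {f : CuspForm (Gamma0 N) 2},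
      pollack_exists_plusMinusPAdicLFunction (W := W) (f := f) (p := p))
    (hmod : nonempty_modularParametrizationData)
    (h5 : realPeriodRat_eq_unit_mul_plusPeriod) (h3 : realPeriodRat_eq_unit_mul_plusPeriod_three)
    (hL20 : Wuthrich2014.lemma20_surjective_threeAdic_of_semistable)
    (hp : p ≠ 2) (hgood : W.HasGoodReductionAtPrime p) (hap : W.frobeniusTrace p = 0)
    (hs : Surj W p) {ε : ℤˣ} (hpair : PairedKobayashiLowerDivisibility W W' p ε) :
    KobayashiLowerDivisibility W' p ε :=
  kobayashiLowerDivisibility_of_paired W' W p h12 h41 hPollack hmod h5 h3 hL20 hp hgood hap hs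
    hpair.symm

/-- **Bookkeeping: under the Kato-side inputs at BOTH curves, the paired lower half is EQUIVALENT to
the two lower halves** — the kernel form of "twist descent of the lower half ⟺ the ± main conjecture
(lower half) over the cyclotomic line of `ℚ(√d)`" (MEMO-4 §F.4), read in product form.
[cite: Kobayashi2003, Thm. 1.2 (p. 2), Thm. 4.1 (p. 8) and Conjecture (p. 2)] -/
theorem pairedKobayashiLowerDivisibility_iff
    (h12 : Kobayashi2003.thm12_signedSelmerDual_finite_torsion)
    (h41 : Kobayashi2003.thm41_signedCharIdeal_divisibility)
    (hPollack : ∀ {N : ℕ} [NeZero N] {f : CuspForm (Gamma0 N) 2},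
      pollack_exists_plusMinusPAdicLFunction (W := W) (f := f) (p := p))
    (hPollack' : ∀ {N : ℕ} [NeZero N] {f : CuspForm (Gamma0 N) 2},
      pollack_exists_plusMinusPAdicLFunction (W := W') (f := f) (p := p))
    (hmod : nonempty_modularParametrizationData)
    (h5 : realPeriodRat_eq_unit_mul_plusPeriod) (h3 : realPeriodRat_eq_unit_mul_plusPeriod_three)
    (hL20 : Wuthrich2014.lemma20_surjective_threeAdic_of_semistable)
    (hp : p ≠ 2) (hgood : W.HasGoodReductionAtPrime p) (hap : W.frobeniusTrace p = 0)
    (hs : Surj W p) (hgood' : W'.HasGoodReductionAtPrime p) (hap' : W'.frobeniusTrace p = 0)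
    (hs' : Surj W' p) (ε : ℤˣ) :
    PairedKobayashiLowerDivisibility W W' p ε ↔
      KobayashiLowerDivisibility W p ε ∧ KobayashiLowerDivisibility W' p ε :=
  ⟨fun h ↦ ⟨kobayashiLowerDivisibility_of_paired W W' p h12 h41 hPollack' hmod h5 h3 hL20 hp hgood'
      hap' hs' h,
    kobayashiLowerDivisibility_of_paired' W W' p h12 h41 hPollack hmod h5 h3 hL20 hp hgood hap hs h⟩,
    fun h ↦ pairedKobayashiLowerDivisibility_of_kobayashiLowerDivisibility h.1 h.2⟩

end Door

/-! ### §3 Corner X7: the partner is a quadratic twist -/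

section X7Twist

variable (W W' : WeierstrassCurve ℚ) [W.IsElliptic] [W.IsGloballyMinimal] [W'.IsElliptic]
  [W'.IsGloballyMinimal] (p : ℕ) [Fact p.Prime]

omit [W'.IsElliptic] in
/-- **Side conditions pass to the twist.** If `W` is good supersingular at the odd prime `p` with
`a_p = 0` and `ρ̄_{W,p}` onto, and `C • W' = W^{(d)}` with `d` square-free, `p ∤ 2d`, then `W'` is good
at `p` with `a_p(W') = (d/p)·a_p(W) = 0` and `ρ̄_{W',p} ≅ ρ̄_{W,p} ⊗ χ_d` onto (tree: `TwistStability`,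
`hasSurjectiveModNGaloisRep_pow_iff_of_model_twist`).
[cite: SilvermanAEC2009, X.5 Cor. 5.4] [cite: Knapp1993, Prop. 12.10] -/
theorem twist_sideConditions (hp : p ≠ 2) (hG : GoodSS W p) (hap : W.frobeniusTrace p = 0)
    (hs : Surj W p) {d : ℤ} (hd : Squarefree d) (hpd : ¬ (p : ℤ) ∣ 2 * d)
    {C : VariableChange ℚ} (hC : C • W' = W.quadraticTwist (d : ℚ)) :
    W'.HasGoodReductionAtPrime p ∧ W'.frobeniusTrace p = 0 ∧ Surj W' p := by
  have _ := hp
  have hd0 : ((d : ℤ) : ℚ) ≠ 0 := by exact_mod_cast hd.ne_zero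
  have hW' : W' = C⁻¹ • W.quadraticTwist (d : ℚ) := by rw [← hC, inv_smul_smul]
  refine ⟨(goodSS_of_smul_eq_quadraticTwist W W' p hG hd hC hpd).1, ?_, ?_⟩
  · rw [frobeniusTrace_of_smul_eq_quadraticTwist W W' p hd hC hpd hG.1, hap, mul_zero]
  · have h1 :=
      Summit.BirchSwinnertonDyer.Rank1Residual.GaloisImage.hasSurjectiveModNGaloisRep_pow_iff_of_model_twist
        W p hd0 (Wd := W') ⟨C⁻¹, hW'.symm⟩ 1
    rw [pow_one] at h1
    exact h1.mpr hs

/-- **X7 × a quadratic-twist partner: Kobayashi's lower half for `W` from the PAIRED lower half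
alone (+ PUB).** At an X7 pair `(W, p)` — `p` odd good supersingular, `W` not semistable — with
`a_p = 0` and `ρ̄_{W,p}` onto, and for ANY globally minimal model `W'` of a quadratic twist `W^{(d)}`
(`d` square-free, `p ∤ 2d`; in the cell's use `d = q*` with `W'` ON the Fouquet–Wan locus, or
`d = d_K` on road B1): `PairedKobayashiLowerDivisibility W W' p ε` ⇒ `KobayashiLowerDivisibility W p ε`,
the published inputs entering BY NAME at `W'`, whose side conditions are discharged by
`twist_sideConditions`. CONDITIONAL on the predicate; closes nothing.
[cite: Kobayashi2003, Thm. 1.2 (p. 2), Thm. 4.1 (p. 8) and Conjecture (p. 2)]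
[cite: SilvermanAEC2009, X.5 Cor. 5.4] -/
theorem X7.kobayashiLowerDivisibility_of_paired_twist
    (h12 : Kobayashi2003.thm12_signedSelmerDual_finite_torsion)
    (h41 : Kobayashi2003.thm41_signedCharIdeal_divisibility)
    (hPollack : ∀ {N : ℕ} [NeZero N] {f : CuspForm (Gamma0 N) 2},
      pollack_exists_plusMinusPAdicLFunction (W := W') (f := f) (p := p))
    (hmod : nonempty_modularParametrizationData)
    (h5 : realPeriodRat_eq_unit_mul_plusPeriod) (h3 : realPeriodRat_eq_unit_mul_plusPeriod_three)
    (hL20 : Wuthrich2014.lemma20_surjective_threeAdic_of_semistable)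
    (hp : p ≠ 2) (hX : ClassX7 W p) (hap : W.frobeniusTrace p = 0) (hs : Surj W p)
    {d : ℤ} (hd : Squarefree d) (hpd : ¬ (p : ℤ) ∣ 2 * d)
    {C : VariableChange ℚ} (hC : C • W' = W.quadraticTwist (d : ℚ))
    {ε : ℤˣ} (hpair : PairedKobayashiLowerDivisibility W W' p ε) :
    KobayashiLowerDivisibility W p ε := by
  obtain ⟨hgood', hap', hs'⟩ := twist_sideConditions W W' p hp hX.1 hap hs hd hpd hC
  exact kobayashiLowerDivisibility_of_paired W W' p h12 h41 hPollack hmod h5 h3 hL20 hp hgood' hap'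
    hs' hpair

/-- **Item 3's conclusion AT THE PAIR from a paired lower half with ANY admissible twist partner.**
Same setting: `∃ ε, KobayashiLowerDivisibility W p ε` ⟸ `PairedKobayashiLowerDivisibility W W' p ε`
for one sign `ε`. [cite: Kobayashi2003, Conjecture (Main Conjecture) (p. 2) and Thm. 4.1 (p. 8)] -/
theorem X7.exists_kobayashiLowerDivisibility_of_paired_twist
    (h12 : Kobayashi2003.thm12_signedSelmerDual_finite_torsion)
    (h41 : Kobayashi2003.thm41_signedCharIdeal_divisibility)
    (hPollack : ∀ {N : ℕ} [NeZero N] {f : CuspForm (Gamma0 N) 2},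
      pollack_exists_plusMinusPAdicLFunction (W := W') (f := f) (p := p))
    (hmod : nonempty_modularParametrizationData)
    (h5 : realPeriodRat_eq_unit_mul_plusPeriod) (h3 : realPeriodRat_eq_unit_mul_plusPeriod_three)
    (hL20 : Wuthrich2014.lemma20_surjective_threeAdic_of_semistable)
    (hp : p ≠ 2) (hX : ClassX7 W p) (hap : W.frobeniusTrace p = 0) (hs : Surj W p)
    {d : ℤ} (hd : Squarefree d) (hpd : ¬ (p : ℤ) ∣ 2 * d)
    {C : VariableChange ℚ} (hC : C • W' = W.quadraticTwist (d : ℚ))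
    (hpair : ∃ ε : ℤˣ, PairedKobayashiLowerDivisibility W W' p ε) :
    ∃ ε : ℤˣ, KobayashiLowerDivisibility W p ε := by
  obtain ⟨ε, hε⟩ := hpair
  exact ⟨ε, X7.kobayashiLowerDivisibility_of_paired_twist W W' p h12 h41 hPollack hmod h5 h3 hL20 hp
    hX hap hs hd hpd hC hε⟩

end X7Twist

/-! ### §4 Pieces B ∪ C: the on-locus twist partner comes with the door -/

section PiecesBC

variable (W : WeierstrassCurve ℚ) [W.IsElliptic] [W.IsGloballyMinimal]

/-- **Pieces B / C of the off-locus partition: the gen-3 twist partner ON the Fouquet–Wan locus,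
together with the paired door.** Let `(W, p)` be an X7 pair, `p` odd, `a_p = 0`, `ρ̄` onto, no CM,
with an ODD prime `ℓ ≠ p` of SPLIT multiplicative reduction and `p ∤ ord_ℓ Δ_min`. Then there are a
prime `q ∉ {2, p}` and a globally minimal model `W'` of `W^{(q)}` such that (a) `W'` is an X7 pair at
`p` with `a_p = 0`, `ρ̄` onto, no CM, lying ON the Fouquet–Wan locus at `ℓ` (gen 3,
`exists_twist_on_fwLocus_of_split_ram`) — so that `W'` satisfies Kobayashi's main conjecture MODULO
`FouquetWan2021_thm451_via_kobayashi74_OPEN` (`X7.kobayashiMainConjecture_of_thm451_OPEN_of_surj`,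
not restated here) —, and (b) for every sign `ε`, the PAIRED lower half for `(W, W')` ALONE (+ the
published inputs BY NAME) gives Kobayashi's lower half for `W` at `p`. The honest missing input at
such a pair is therefore ONE K-level statement for `(E, ℚ(√q*))`, the native output of the
Eisenstein-congruence engines; FW's own auxiliary field ramifies `ℓ`, so FW's proof does not supply
it. CONDITIONAL; closes nothing. [cite: Kobayashi2003, Thm. 4.1 (p. 8) and Conjecture (p. 2)]
[cite: SilvermanAEC2009, VII.5 Prop. 5.1(b), X.5 Cor. 5.4 and VIII.8 Cor. 8.3] -/
theorem X7.exists_fwLocus_twist_pairedDoor_of_split_ram (p : ℕ) [Fact p.Prime]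
    (h12 : Kobayashi2003.thm12_signedSelmerDual_finite_torsion)
    (h41 : Kobayashi2003.thm41_signedCharIdeal_divisibility)
    (hPollack : ∀ (V : WeierstrassCurve ℚ) [V.IsElliptic] [V.IsGloballyMinimal]
      {N : ℕ} [NeZero N] {f : CuspForm (Gamma0 N) 2},
      pollack_exists_plusMinusPAdicLFunction (W := V) (f := f) (p := p))
    (hmod : nonempty_modularParametrizationData)
    (h5 : realPeriodRat_eq_unit_mul_plusPeriod) (h3 : realPeriodRat_eq_unit_mul_plusPeriod_three)
    (hL20 : Wuthrich2014.lemma20_surjective_threeAdic_of_semistable)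
    (hp : p ≠ 2) (hX : ClassX7 W p) (hcm : ¬ W.HasCM) (hap : W.frobeniusTrace p = 0) (hs : Surj W p)
    {ℓ : ℕ} [Fact ℓ.Prime] (hℓ2 : ℓ ≠ 2) (hℓp : ℓ ≠ p)
    (hmult : W.HasMultiplicativeReductionAtPrime ℓ)
    (hsplit : W.HasSplitMultiplicativeReductionAtPrime ℓ)
    (hram : ¬ p ∣ padicValInt ℓ W.minimalDiscriminantInt) :
    ∃ (q : ℕ) (_ : Fact q.Prime) (W' : WeierstrassCurve ℚ) (_ : W'.IsElliptic)
      (_ : W'.IsGloballyMinimal) (C : VariableChange ℚ),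
      q ≠ 2 ∧ q ≠ p ∧ C • W' = W.quadraticTwist ((q : ℤ) : ℚ) ∧
      (ClassX7 W' p ∧ ¬ W'.HasCM ∧ W'.frobeniusTrace p = 0 ∧ Surj W' p ∧
        (ℓ ≠ p ∧ W'.HasMultiplicativeReductionAtPrime ℓ ∧
          ¬ W'.HasSplitMultiplicativeReductionAtPrime ℓ ∧
          ¬ p ∣ padicValInt ℓ W'.minimalDiscriminantInt)) ∧
      ∀ ε : ℤˣ, PairedKobayashiLowerDivisibility W W' p ε → KobayashiLowerDivisibility W p ε := by
  obtain ⟨q, hq, W', hE', hM', C, hq2, hqp, hC, hX', hcm', hap', hs', hloc⟩ :=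
    exists_twist_on_fwLocus_of_split_ram W p hp hX hcm hap hs hℓ2 hℓp hmult hsplit hram
  refine ⟨q, hq, W', hE', hM', C, hq2, hqp, hC, ⟨hX', hcm', hap', hs', hloc⟩, fun ε hpair ↦ ?_⟩
  exact kobayashiLowerDivisibility_of_paired W W' p h12 h41 (hPollack W') hmod h5 h3 hL20 hp
    hX'.1.1 hap' hs' hpair

end PiecesBC

end Summit.BirchSwinnertonDyer.BirchSwinnertonDyer.Theorems

end
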